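import Summits.KontsevichZagierPeriods.KontsevichZagierPeriods.Theorems.K2SymbolChainsJensenIsScissorsDoublingA

/-!
# Jensen is scissors — the doubling step, part B: `[L(W_ρ · W_{−ρ})] ~ [L(ρ²)]`, and the step

Support file for item stmt-KontsevichZagierPeriods-5204 (`JensenIsScissors`, route
KontsevichZagierPeriods/K2SymbolChains). Continuing part A: `W_ρ W_{−ρ} = W_{ρ²} ∘ (s ↦ 2s/(1 − s²))`
(`|e^{2iφ} − ρ²| = |e^{iφ} − ρ| |e^{iφ} + ρ|`) on the two sheets `{s² < 1}`, `{s² > 1}`, each carried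
by rule 2) onto the unfolding of `(h/2) log W_{ρ²}` over (a co-null part of) the whole line, and
`2 · (h/2) = h` is integrand additivity (rule 1b)); all up to null sets (rule 1a)). Together with
part A: `2 [L(ρ)] − [L(ρ²)] ∈ S` (`doubling_step`). [Kontsevich–Zagier 2001, §1.2, rules 1)–2)]
[folklore]
-/

noncomputable section

open MeasureTheory Set
open Literature.NumberTheory.Transcendental Literature.ModelTheory.ExponentialFields

namespace Summit.KontsevichZagierPeriods.K2SymbolChains.JensenIsScissorsProof

open Literature.NumberTheory.Transcendental.KZ

variable {n : ℕ} {S : AddSubgroup FormalRep}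

/-- **Doubling, part B**: `[L(W_ρ · W_{−ρ})] − [L(ρ²)] ∈ S`. See the module docstring.
[Kontsevich–Zagier 2001, §1.2] [folklore] -/
theorem doubling_partB (hS : domainAddRel ∪ integrandAddRel ∪ changeOfVariablesRel ⊆ S)
    {B : Set (Fin n → ℝ)} {h ρ : (Fin n → ℝ) → ℝ}
    (hB : IsSemialgebraic ℚ B) (hh : IsSemialgebraicFunOn ℚ B h) (hρs : IsSemialgebraicFunOn ℚ B ρ)
    (hρ0 : ∀ x ∈ B, 0 ≤ ρ x) (hhi : IntegrableOn h B)
    (R₁₂ : IntegralRep (n + 1 + 1))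
    (hR₁₂d' : R₁₂.domain = logUnfoldDomain {b : Fin (n + 1) → ℝ | Fin.init b ∈ B ∧
        ((1 - ρ (Fin.init b)) ^ 2 + (1 + ρ (Fin.init b)) ^ 2 * b (Fin.last n) ^ 2) /
          (1 + b (Fin.last n) ^ 2) ≠ 0}
        (fun b => ((1 - ρ (Fin.init b)) ^ 2 + (1 + ρ (Fin.init b)) ^ 2 * b (Fin.last n) ^ 2) /
          (1 + b (Fin.last n) ^ 2) *
          (((1 + ρ (Fin.init b)) ^ 2 + (1 - ρ (Fin.init b)) ^ 2 * b (Fin.last n) ^ 2) /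
            (1 + b (Fin.last n) ^ 2))))
    (hR₁₂i : R₁₂.integrand = logUnfoldIntegrand (fun b => h (Fin.init b) / (1 + b (Fin.last n) ^ 2))) :
    ∃ R₂ : IntegralRep (n + 1 + 1),
      R₂.domain = logUnfoldDomain {b : Fin (n + 1) → ℝ | Fin.init b ∈ B}
        (fun b => ((1 - ρ (Fin.init b) ^ 2) ^ 2 + (1 + ρ (Fin.init b) ^ 2) ^ 2 * b (Fin.last n) ^ 2) /
          (1 + b (Fin.last n) ^ 2)) ∧
      R₂.integrand = logUnfoldIntegrand (fun b => h (Fin.init b) / (1 + b (Fin.last n) ^ 2)) ∧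
      of R₁₂ - of R₂ ∈ S := by
  -- notation
  set T : Set (Fin (n + 1) → ℝ) := {b | Fin.init b ∈ B} with hT_def
  set G : (Fin (n + 1) → ℝ) → ℝ := fun b => h (Fin.init b) / (1 + b (Fin.last n) ^ 2) with hG_def
  set Gh : (Fin (n + 1) → ℝ) → ℝ := fun b => (h (Fin.init b) / 2) / (1 + b (Fin.last n) ^ 2) with hGh_def
  set W : (Fin (n + 1) → ℝ) → ℝ := fun b =>
    ((1 - ρ (Fin.init b)) ^ 2 + (1 + ρ (Fin.init b)) ^ 2 * b (Fin.last n) ^ 2) / (1 + b (Fin.last n) ^ 2)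
    with hW_def
  set Wm : (Fin (n + 1) → ℝ) → ℝ := fun b =>
    ((1 + ρ (Fin.init b)) ^ 2 + (1 - ρ (Fin.init b)) ^ 2 * b (Fin.last n) ^ 2) / (1 + b (Fin.last n) ^ 2)
    with hWm_def
  set W₂ : (Fin (n + 1) → ℝ) → ℝ := fun b =>
    ((1 - ρ (Fin.init b) ^ 2) ^ 2 + (1 + ρ (Fin.init b) ^ 2) ^ 2 * b (Fin.last n) ^ 2) /
      (1 + b (Fin.last n) ^ 2) with hW₂_def
  -- semialgebraicity
  have hT : IsSemialgebraic ℚ T := isSemialgebraic_cyl hB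
  have hGT : IsSemialgebraicFunOn ℚ T G := isSemialgebraicFunOn_weight hh hT subset_rfl
  have hh2 : IsSemialgebraicFunOn ℚ B (fun x => h x / 2) :=
    IsSemialgebraicFunOn.div hh (isSemialgebraicFunOn_ratCast hB 2 |>.congr fun _ _ => by simp) fun _ _ => by norm_num
  have hGhT : IsSemialgebraicFunOn ℚ T Gh := isSemialgebraicFunOn_weight hh2 hT subset_rfl
  have hWT : IsSemialgebraicFunOn ℚ T W := isSemialgebraicFunOn_Wreal hρs hT subset_rfl
  have hWmT : IsSemialgebraicFunOn ℚ T Wm := by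
    have := isSemialgebraicFunOn_Wreal (ρ := fun x => -ρ x) hρs.neg hT subset_rfl
    refine this.congr fun b _ => ?_
    simp only [hWm_def]
    ring
  have hρ2s : IsSemialgebraicFunOn ℚ B (fun x => ρ x ^ 2) :=
    (IsSemialgebraicFunOn.mul_holds hρs hρs).congr fun x _ => by simp [sq]
  have hW₂T : IsSemialgebraicFunOn ℚ T W₂ := isSemialgebraicFunOn_Wreal hρ2s hT subset_rfl
  have hsT := isSemialgebraicFunOn_apply hT (Fin.last n)
  -- positivity
  have hW0 : ∀ b ∈ T, 0 ≤ W b := fun b _ => by simp only [hW_def]; positivity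
  have hWm0 : ∀ b ∈ T, 0 < Wm b := fun b hb => by
    have h1 : 0 < 1 + ρ (Fin.init b) := by have := hρ0 _ hb; linarith
    simp only [hWm_def]
    positivity
  have hW₂0 : ∀ b ∈ T, 0 ≤ W₂ b := fun b _ => by simp only [hW₂_def]; positivity
  have hWne : ∀ b ∈ T, b (Fin.last n) ≠ 0 → W b ≠ 0 := fun b hb hs => by
    have h1 : (1 + ρ (Fin.init b)) ≠ 0 := by have := hρ0 _ hb; positivity
    exact W_ne_zero_of_ne h1 hs
  have hW₂ne : ∀ b ∈ T, b (Fin.last n) ≠ 0 → W₂ b ≠ 0 := fun b hb hs => by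
    have h1 : (1 + ρ (Fin.init b) ^ 2) ≠ 0 := by positivity
    exact W_ne_zero_of_ne h1 hs
  -- the good bases
  set T₀ : Set (Fin (n + 1) → ℝ) := {b | b ∈ T ∧ W b ≠ 0} with hT₀_def
  set σ : Set (Fin (n + 1) → ℝ) := {b | b ∈ T ∧ b (Fin.last n) ≠ 0} with hσ_def
  set T₂ : Set (Fin (n + 1) → ℝ) := {b | b ∈ T ∧ W₂ b ≠ 0} with hT₂_def
  have hT₀s : IsSemialgebraic ℚ T₀ := hWT.isSemialgebraic_sep_ne_zero
  have hσs : IsSemialgebraic ℚ σ := hsT.isSemialgebraic_sep_ne_zero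
  have hT₂s : IsSemialgebraic ℚ T₂ := hW₂T.isSemialgebraic_sep_ne_zero
  have hT₀T : T₀ ⊆ T := fun b hb => hb.1
  have hσT : σ ⊆ T := fun b hb => hb.1
  have hT₂T : T₂ ⊆ T := fun b hb => hb.1
  have hσT₀ : σ ⊆ T₀ := fun b hb => ⟨hb.1, hWne b hb.1 hb.2⟩
  have hσT₂ : σ ⊆ T₂ := fun b hb => ⟨hb.1, hW₂ne b hb.1 hb.2⟩
  -- null sets: everything bad lies in `{s = 0} ∪ {s = 1} ∪ {s = -1}`
  have hnull0 : volume {b : Fin (n + 1) → ℝ | b (Fin.last n) = 0} = 0 := volume_setOf_last_eq_zero 0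
  have hnull1 : volume {b : Fin (n + 1) → ℝ | b (Fin.last n) = 1} = 0 := volume_setOf_last_eq_zero 1
  have hnullm1 : volume {b : Fin (n + 1) → ℝ | b (Fin.last n) = -1} = 0 := volume_setOf_last_eq_zero (-1)
  have hTT₀ : volume (T \ T₀) = 0 := measure_mono_null (fun b hb => by
    by_contra hs
    exact hb.2 ⟨hb.1, hWne b hb.1 hs⟩) hnull0
  have hT₀σ : volume (T₀ \ σ) = 0 := measure_mono_null (fun b hb => by
    by_contra hs
    exact hb.2 ⟨hb.1.1, hs⟩) hnull0
  have hTT₂ : volume (T \ T₂) = 0 := measure_mono_null (fun b hb => by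
    by_contra hs
    exact hb.2 ⟨hb.1, hW₂ne b hb.1 hs⟩) hnull0
  have hT₂σ : volume (T₂ \ σ) = 0 := measure_mono_null (fun b hb => by
    by_contra hs
    exact hb.2 ⟨hb.1.1, hs⟩) hnull0
  -- integrability of the weight on `T`
  have hGi : IntegrableOn G T := by
    have := integrableOn_cyl_mul (B := B) (f := h) (g := fun s : ℝ => (1 + s ^ 2)⁻¹) hhi integrable_inv_one_add_sq
    refine this.congr_fun (fun b _ => ?_) (IsSemialgebraic.measurableSet_holds hT)
    simp only [hG_def, div_eq_mul_inv]
  ----------------------------------------------------------------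
  -- step 4: the two sheets of the doubling chart
  ----------------------------------------------------------------
  have hs2T₀ : IsSemialgebraicFunOn ℚ T₀ (fun b : Fin (n + 1) → ℝ => b (Fin.last n) ^ 2 - 1) :=
    (IsSemialgebraicFunOn.sub_holds (IsSemialgebraicFunOn.mul_holds (hsT.mono hT₀T hT₀s) (hsT.mono hT₀T hT₀s))
      (isSemialgebraicFunOn_ratCast hT₀s 1)).congr fun b _ => by simp [sq]
  have hs2T₀' : IsSemialgebraicFunOn ℚ T₀ (fun b : Fin (n + 1) → ℝ => 1 - b (Fin.last n) ^ 2) :=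
    hs2T₀.neg.congr fun b _ => by simp
  set C₁ : Set (Fin (n + 1) → ℝ) := {b | b ∈ T₀ ∧ b (Fin.last n) ^ 2 - 1 < 0} with hC₁_def
  set C₂ : Set (Fin (n + 1) → ℝ) := {b | b ∈ T₀ ∧ 1 - b (Fin.last n) ^ 2 < 0} with hC₂_def
  have hC₁s : IsSemialgebraic ℚ C₁ := hs2T₀.isSemialgebraic_sep_neg
  have hC₂s : IsSemialgebraic ℚ C₂ := hs2T₀'.isSemialgebraic_sep_neg
  have hC₁T₀ : C₁ ⊆ T₀ := fun b hb => hb.1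
  have hC₂T₀ : C₂ ⊆ T₀ := fun b hb => hb.1
  have hC₁lt : ∀ b ∈ C₁, b (Fin.last n) ^ 2 < 1 := fun b hb => by have := hb.2; linarith
  have hC₂gt : ∀ b ∈ C₂, 1 < b (Fin.last n) ^ 2 := fun b hb => by have := hb.2; linarith
  have hC₁ne : ∀ b ∈ C₁, 1 - b (Fin.last n) ^ 2 ≠ 0 := fun b hb => by have := hC₁lt b hb; linarith
  have hC₂ne : ∀ b ∈ C₂, 1 - b (Fin.last n) ^ 2 ≠ 0 := fun b hb => by have := hC₂gt b hb; linarith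
  -- split `R₁₂` along the two sheets
  have hR₁₂d : R₁₂.domain = logUnfoldDomain T₀ (fun b => W b * Wm b) := hR₁₂d'
  set A₁ := R₁₂.restrict (R₁₂.domain ∩ {z | Fin.init z ∈ C₁})
    (R₁₂.isSemialgebraic_domain.inter (isSemialgebraic_cyl hC₁s)) inter_subset_left with hA₁
  set A₂ := R₁₂.restrict (R₁₂.domain ∩ {z | Fin.init z ∈ C₂})
    (R₁₂.isSemialgebraic_domain.inter (isSemialgebraic_cyl hC₂s)) inter_subset_left with hA₂
  have e4 : of R₁₂ - of A₁ - of A₂ ∈ S := by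
    refine of_sub_restrict_sub_restrict_mem_of_null hS R₁₂ _ _ inter_subset_left inter_subset_left ?_ ?_
    · rw [show (R₁₂.domain ∩ {z | Fin.init z ∈ C₁}) ∩ (R₁₂.domain ∩ {z | Fin.init z ∈ C₂}) = ∅ by
        ext z
        simp only [mem_inter_iff, mem_setOf_eq, mem_empty_iff_false, iff_false, not_and, and_imp]
        intro _ h1 _ h2
        have := h1.2; have := h2.2; linarith]
      exact measure_empty
    · refine measure_mono_null (fun z hz => ?_)
        (volume_setOf_init_mem_eq_zero (measure_union_null hnull1 hnullm1))
      obtain ⟨hz, hn⟩ := hz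
      have hbT₀ : Fin.init z ∈ T₀ := by rw [hR₁₂d] at hz; exact hz.1
      simp only [mem_union, mem_inter_iff, mem_setOf_eq, not_or, not_and] at hn
      have h1 : ¬ (Fin.init z (Fin.last n) ^ 2 - 1 < 0) := fun h => hn.1 hz ⟨hbT₀, h⟩
      have h2 : ¬ (1 - Fin.init z (Fin.last n) ^ 2 < 0) := fun h => hn.2 hz ⟨hbT₀, h⟩
      have hsq : Fin.init z (Fin.last n) ^ 2 = 1 := by linarith [not_lt.1 h1, not_lt.1 h2]
      rcases sq_eq_one_iff.1 hsq with h | h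
      · exact Or.inl h
      · exact Or.inr h
  have hA₁d : A₁.domain = logUnfoldDomain C₁ (fun b => W b * Wm b) := by
    rw [hA₁, IntegralRep.domain_restrict, hR₁₂d, logUnfoldDomain_inter_cyl, inter_eq_right.2 hC₁T₀]
  have hA₂d : A₂.domain = logUnfoldDomain C₂ (fun b => W b * Wm b) := by
    rw [hA₂, IntegralRep.domain_restrict, hR₁₂d, logUnfoldDomain_inter_cyl, inter_eq_right.2 hC₂T₀]
  -- the chart as rule-2) data on each sheet
  have hψs : ∀ {C : Set (Fin (n + 1) → ℝ)}, IsSemialgebraic ℚ C → C ⊆ T₀ →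
      (∀ b ∈ C, 1 - b (Fin.last n) ^ 2 ≠ 0) →
      IsSemialgebraicFunOn ℚ C (fun b : Fin (n + 1) → ℝ => 2 * b (Fin.last n) / (1 - b (Fin.last n) ^ 2)) :=
    fun hC hCT hne => IsSemialgebraicFunOn.div
      ((IsSemialgebraicFunOn.mul_holds (isSemialgebraicFunOn_ratCast hC 2) (hsT.mono (hCT.trans hT₀T) hC)).congr
        fun b _ => by simp) (hs2T₀'.mono hCT hC) hne
  have hψd : ∀ b : Fin (n + 1) → ℝ, 1 - b (Fin.last n) ^ 2 ≠ 0 →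
      DifferentiableAt ℝ (fun b : Fin (n + 1) → ℝ => 2 * b (Fin.last n) / (1 - b (Fin.last n) ^ 2)) b :=
    fun b hb => by
      have hs : DifferentiableAt ℝ (fun w : Fin (n + 1) → ℝ => w (Fin.last n)) b :=
        differentiableAt_apply (𝕜 := ℝ) (Fin.last n) b
      simp only [div_eq_mul_inv]
      exact (hs.const_mul 2).mul (((differentiableAt_const _).sub (hs.pow 2)).inv hb)
  have hψderiv : ∀ b : Fin (n + 1) → ℝ, 1 - b (Fin.last n) ^ 2 ≠ 0 →
      fderiv ℝ (fun b : Fin (n + 1) → ℝ => 2 * b (Fin.last n) / (1 - b (Fin.last n) ^ 2)) b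
        (Pi.single (Fin.last n) 1) = 2 * (1 + b (Fin.last n) ^ 2) / (1 - b (Fin.last n) ^ 2) ^ 2 :=
    fun b hb => fderiv_apply_single_last (hψd b hb).hasFDerivAt (by simpa using hasDerivAt_dbl hb)
  have hPW₂ : ∀ b : Fin (n + 1) → ℝ, 1 - b (Fin.last n) ^ 2 ≠ 0 → W b * Wm b =
      W₂ (Fin.snoc (Fin.init b) (2 * b (Fin.last n) / (1 - b (Fin.last n) ^ 2))) := fun b hb => by
    simp only [hW_def, hWm_def, hW₂_def, Fin.init_snoc, Fin.snoc_last]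
    exact dbl_W _ hb
  have hwt : ∀ b : Fin (n + 1) → ℝ, 1 - b (Fin.last n) ^ 2 ≠ 0 →
      Gh (Fin.snoc (Fin.init b) (2 * b (Fin.last n) / (1 - b (Fin.last n) ^ 2))) *
        (2 * (1 + b (Fin.last n) ^ 2) / (1 - b (Fin.last n) ^ 2) ^ 2) = G b := fun b hb => by
    simp only [hGh_def, hG_def, Fin.init_snoc, Fin.snoc_last]
    exact dbl_weight _ hb
  -- the integrand transport, common to both sheets
  have hint_chart : ∀ {C : Set (Fin (n + 1) → ℝ)} (A : IntegralRep (n + 1 + 1)),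
      A.domain = logUnfoldDomain C (fun b => W b * Wm b) → (∀ b ∈ C, 1 - b (Fin.last n) ^ 2 ≠ 0) →
      EqOn A.integrand (logUnfoldIntegrand G) A.domain →
      ∀ z ∈ A.domain, A.integrand z = logUnfoldIntegrand Gh
        (Fin.snoc (Fin.snoc (Fin.init (Fin.init z)) (2 * (Fin.init z) (Fin.last n) /
          (1 - (Fin.init z) (Fin.last n) ^ 2))) (z (Fin.last (n + 1)))) *
        |(ContinuousLinearMap.pi (Fin.lastCases (motive := fun _ => (Fin (n + 1) → ℝ) →L[ℝ] ℝ)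
            (fderiv ℝ (fun b : Fin (n + 1) → ℝ => 2 * b (Fin.last n) / (1 - b (Fin.last n) ^ 2)) (Fin.init z))
            (fun i => ContinuousLinearMap.proj (Fin.castSucc i))) :
              (Fin (n + 1) → ℝ) →L[ℝ] (Fin (n + 1) → ℝ)).det| := by
    intro C A hAd hne hAi z hz
    have hb : Fin.init z ∈ C := by rw [hAd] at hz; exact hz.1
    rw [hAi hz, det_lastCoordDeriv, hψderiv _ (hne _ hb), abs_of_pos (dbl_deriv_pos (hne _ hb)),
      logUnfoldIntegrand, logUnfoldIntegrand]
    simp only [Fin.init_snoc, Fin.snoc_last]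
    rw [← hwt _ (hne _ hb)]
    ring
  -- sheet 1: `{s² < 1}` onto the good base `T₂` of `W₂`
  obtain ⟨map₁, der₁, inj₁⟩ := lastCoord_covData_basic (m := n) hC₁s (hψs hC₁s hC₁T₀ hC₁ne)
    (F' := fun b => fderiv ℝ (fun b : Fin (n + 1) → ℝ => 2 * b (Fin.last n) / (1 - b (Fin.last n) ^ 2)) b)
    (fun b hb => (hψd b (hC₁ne b hb)).hasFDerivAt)
    (fun b₁ hb₁ b₂ hb₂ hi hm => by
      have := dbl_inj_of_lt (hC₁lt _ hb₁) (hC₁lt _ hb₂) hm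
      rw [← Fin.snoc_init_self b₁, ← Fin.snoc_init_self b₂, hi, this])
  obtain ⟨Rh₁, hRh₁d, hRh₁i, e5⟩ := exists_image_baseLift hS map₁ der₁ inj₁ A₁
    (by rw [hA₁d]; exact fun z hz => hz.1) (D' := logUnfoldDomain T₂ W₂) (fun z hz => by
      obtain ⟨⟨hbT, hW₂b⟩, -⟩ := hz
      obtain ⟨hlt, hψ⟩ := dbl_inv₁ ((Fin.init z) (Fin.last n))
      set t := (Fin.init z) (Fin.last n) with ht
      set b : Fin (n + 1) → ℝ := Fin.snoc (Fin.init (Fin.init z)) (t / (1 + Real.sqrt (1 + t ^ 2))) with hb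
      have hbs : b (Fin.last n) = t / (1 + Real.sqrt (1 + t ^ 2)) := by simp [hb]
      have hbi : Fin.init b = Fin.init (Fin.init z) := by simp [hb]
      have hne1 : 1 - b (Fin.last n) ^ 2 ≠ 0 := by rw [hbs]; linarith
      have hΨb : (Fin.snoc (Fin.init b) (2 * b (Fin.last n) / (1 - b (Fin.last n) ^ 2)) : Fin (n + 1) → ℝ) =
          Fin.init z := by rw [hbi, hbs, hψ, ht, Fin.snoc_init_self]
      refine ⟨b, ⟨⟨by simpa [hT_def, hbi] using hbT, fun h0 => hW₂b ?_⟩, by rw [hbs]; linarith⟩, hΨb⟩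
      rw [← hΨb, ← hPW₂ b hne1, h0, zero_mul])
    (fun b hb u => by
      rw [hA₁d, snoc_mem_logUnfoldDomain, snoc_mem_logUnfoldDomain, hPW₂ b (hC₁ne b hb)]
      refine ⟨fun h => ⟨⟨by simpa [hT_def] using hb.1.1, ?_⟩, h.2⟩, fun h => ⟨hb, h.2⟩⟩
      rw [← hPW₂ b (hC₁ne b hb)]
      exact mul_ne_zero hb.1.2 (hWm0 _ hb.1.1).ne')
    (f' := logUnfoldIntegrand Gh)
    (isSemialgebraicFunOn_logUnfoldIntegrand (hGhT.mono hT₂T hT₂s) (hW₂T.mono hT₂T hT₂s) fun b hb => hW₂0 b hb.1)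
    (hint_chart A₁ hA₁d hC₁ne (fun z _ => by show R₁₂.integrand z = _; rw [hR₁₂i]))
  -- sheet 2: `{s² > 1}` onto `σ = {s ≠ 0}`
  obtain ⟨map₂, der₂, inj₂⟩ := lastCoord_covData_basic (m := n) hC₂s (hψs hC₂s hC₂T₀ hC₂ne)
    (F' := fun b => fderiv ℝ (fun b : Fin (n + 1) → ℝ => 2 * b (Fin.last n) / (1 - b (Fin.last n) ^ 2)) b)
    (fun b hb => (hψd b (hC₂ne b hb)).hasFDerivAt)
    (fun b₁ hb₁ b₂ hb₂ hi hm => by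
      have := dbl_inj_of_gt (hC₂gt _ hb₁) (hC₂gt _ hb₂) hm
      rw [← Fin.snoc_init_self b₁, ← Fin.snoc_init_self b₂, hi, this])
  obtain ⟨Rh₂, hRh₂d, hRh₂i, e6⟩ := exists_image_baseLift hS map₂ der₂ inj₂ A₂
    (by rw [hA₂d]; exact fun z hz => hz.1) (D' := logUnfoldDomain σ W₂) (fun z hz => by
      obtain ⟨⟨hbT, ht0⟩, -⟩ := hz
      obtain ⟨hgt, hψ⟩ := dbl_inv₂ ht0
      set t := (Fin.init z) (Fin.last n) with ht
      set b : Fin (n + 1) → ℝ := Fin.snoc (Fin.init (Fin.init z)) (-(1 + Real.sqrt (1 + t ^ 2)) / t) with hb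
      have hbs : b (Fin.last n) = -(1 + Real.sqrt (1 + t ^ 2)) / t := by simp [hb]
      have hbi : Fin.init b = Fin.init (Fin.init z) := by simp [hb]
      have hne1 : 1 - b (Fin.last n) ^ 2 ≠ 0 := by rw [hbs]; linarith
      have hΨb : (Fin.snoc (Fin.init b) (2 * b (Fin.last n) / (1 - b (Fin.last n) ^ 2)) : Fin (n + 1) → ℝ) =
          Fin.init z := by rw [hbi, hbs, hψ, ht, Fin.snoc_init_self]
      have hbT' : b ∈ T := by simpa [hT_def, hbi] using hbT
      refine ⟨b, ⟨⟨hbT', ?_⟩, by rw [hbs]; linarith⟩, hΨb⟩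
      intro h0
      have hW₂0' : W₂ (Fin.init z) = 0 := by rw [← hΨb, ← hPW₂ b hne1, h0, zero_mul]
      exact hW₂ne _ hbT ht0 hW₂0')
    (fun b hb u => by
      rw [hA₂d, snoc_mem_logUnfoldDomain, snoc_mem_logUnfoldDomain, hPW₂ b (hC₂ne b hb)]
      refine ⟨fun h => ⟨⟨by simpa [hT_def] using hb.1.1, ?_⟩, h.2⟩, fun h => ⟨hb, h.2⟩⟩
      simp only [Fin.snoc_last]
      have hs0 : b (Fin.last n) ≠ 0 := by
        intro h0; have := hC₂gt b hb; rw [h0] at this; norm_num at this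
      exact div_ne_zero (mul_ne_zero two_ne_zero hs0) (hC₂ne b hb))
    (f' := logUnfoldIntegrand Gh)
    (isSemialgebraicFunOn_logUnfoldIntegrand (hGhT.mono hσT hσs) (hW₂T.mono hσT hσs) fun b hb => hW₂0 b hb.1)
    (hint_chart A₂ hA₂d hC₂ne (fun z _ => by show R₁₂.integrand z = _; rw [hR₁₂i]))
  -- extend sheet 2's image to `T₂` and identify with sheet 1's image
  obtain ⟨Rh₂e, hRh₂ed, hRh₂ei, e7⟩ := exists_extend_null hS Rh₂ (D := logUnfoldDomain T₂ W₂)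
    (isSemialgebraic_logUnfoldDomain (hW₂T.mono hT₂T hT₂s))
    (by rw [hRh₂d]; exact fun z hz => ⟨hσT₂ hz.1, hz.2⟩)
    (by
      rw [hRh₂d]
      refine measure_mono_null (fun z hz => ?_) (volume_setOf_init_mem_eq_zero hT₂σ)
      obtain ⟨⟨hzT, hu⟩, hn⟩ := hz
      exact ⟨hzT, fun h => hn ⟨h, hu⟩⟩)
    (f := logUnfoldIntegrand Gh)
    (isSemialgebraicFunOn_logUnfoldIntegrand (hGhT.mono hT₂T hT₂s) (hW₂T.mono hT₂T hT₂s) fun b hb => hW₂0 b hb.1)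
    (by rw [hRh₂i]; exact fun _ _ => rfl)
  have e8 : of Rh₁ - of Rh₂e ∈ S :=
    of_sub_of_mem_of_eqOn hS (by rw [hRh₂ed, hRh₁d]) (by rw [hRh₁i, hRh₂ei]; exact fun _ _ => rfl)
  ----------------------------------------------------------------
  -- step 5: `2 · (h/2) = h` (integrand additivity) on `T₂`
  ----------------------------------------------------------------
  have hGG : ∀ z, logUnfoldIntegrand G z = logUnfoldIntegrand Gh z + logUnfoldIntegrand Gh z := fun z => by
    simp only [logUnfoldIntegrand, hG_def, hGh_def]
    ring
  set R₂' : IntegralRep (n + 1 + 1) :=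
    { domain := logUnfoldDomain T₂ W₂
      integrand := logUnfoldIntegrand G
      isSemialgebraic_domain := isSemialgebraic_logUnfoldDomain (hW₂T.mono hT₂T hT₂s)
      isSemialgebraicFunOn_integrand :=
        isSemialgebraicFunOn_logUnfoldIntegrand (hGT.mono hT₂T hT₂s) (hW₂T.mono hT₂T hT₂s) fun b hb => hW₂0 b hb.1
      integrableOn := by
        have h2 : IntegrableOn (fun x => 2 * logUnfoldIntegrand Gh x) (logUnfoldDomain T₂ W₂) := by
          have := Rh₁.integrableOn.const_mul 2
          rw [hRh₁d, hRh₁i] at this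
          exact this
        refine h2.congr_fun (fun z _ => ?_)
          (IsSemialgebraic.measurableSet_holds (isSemialgebraic_logUnfoldDomain (hW₂T.mono hT₂T hT₂s)))
        simp only [hGG z, two_mul] } with hR₂'
  have e9 : of R₂' - of Rh₁ - of Rh₁ ∈ S :=
    of_sub_of_sub_mem_of_add hS hRh₁d hRh₁d (fun z _ => by rw [hRh₁i, Pi.add_apply]; exact hGG z)
  ----------------------------------------------------------------
  -- step 6: extend to the full base `T`
  ----------------------------------------------------------------
  obtain ⟨R₂, hR₂d, hR₂i, e10⟩ := exists_extend_null hS R₂' (D := logUnfoldDomain T W₂)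
    (isSemialgebraic_logUnfoldDomain hW₂T) (fun z hz => ⟨hT₂T hz.1, hz.2⟩)
    (by
      refine measure_mono_null (fun z hz => ?_) (volume_setOf_init_mem_eq_zero hTT₂)
      obtain ⟨⟨hzT, hu⟩, hn⟩ := hz
      exact ⟨hzT, fun h => hn ⟨h, hu⟩⟩)
    (f := logUnfoldIntegrand G)
    (isSemialgebraicFunOn_logUnfoldIntegrand hGT hW₂T hW₂0) (fun _ _ => rfl)
  refine ⟨R₂, hR₂d, hR₂i, ?_⟩
  have : of R₁₂ - of R₂ = (of R₁₂ - of A₁ - of A₂) + (of A₁ - of Rh₁) + (of A₂ - of Rh₂) - (of Rh₂e - of Rh₂) -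
      (of Rh₁ - of Rh₂e) - (of R₂' - of Rh₁ - of Rh₁) - (of R₂ - of R₂') := by abel
  rw [this]
  exact S.sub_mem (S.sub_mem (S.sub_mem (S.sub_mem (S.add_mem (S.add_mem e4 e5) e6) e7) e8) e9) e10

/-- **The doubling step** `2 [L(ρ)] − [L(ρ²)] ∈ S` (parts A and B). [Kontsevich–Zagier 2001, §1.2]
[folklore] -/
theorem doubling_step (hS : domainAddRel ∪ integrandAddRel ∪ changeOfVariablesRel ⊆ S)
    {B : Set (Fin n → ℝ)} {h ρ : (Fin n → ℝ) → ℝ}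
    (hB : IsSemialgebraic ℚ B) (hh : IsSemialgebraicFunOn ℚ B h) (hρs : IsSemialgebraicFunOn ℚ B ρ)
    (hρ0 : ∀ x ∈ B, 0 ≤ ρ x) (hρd : ∀ x ∈ B, DifferentiableAt ℝ ρ x) (hhi : IntegrableOn h B)
    (R : IntegralRep (n + 1 + 1))
    (hRd : R.domain = logUnfoldDomain {b : Fin (n + 1) → ℝ | Fin.init b ∈ B}
      (fun b => ((1 - ρ (Fin.init b)) ^ 2 + (1 + ρ (Fin.init b)) ^ 2 * b (Fin.last n) ^ 2) /
        (1 + b (Fin.last n) ^ 2)))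
    (hRi : EqOn R.integrand
      (logUnfoldIntegrand fun b => h (Fin.init b) / (1 + b (Fin.last n) ^ 2)) R.domain) :
    ∃ R₂ : IntegralRep (n + 1 + 1),
      R₂.domain = logUnfoldDomain {b : Fin (n + 1) → ℝ | Fin.init b ∈ B}
        (fun b => ((1 - ρ (Fin.init b) ^ 2) ^ 2 + (1 + ρ (Fin.init b) ^ 2) ^ 2 * b (Fin.last n) ^ 2) /
          (1 + b (Fin.last n) ^ 2)) ∧
      R₂.integrand = logUnfoldIntegrand (fun b => h (Fin.init b) / (1 + b (Fin.last n) ^ 2)) ∧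
      2 • of R - of R₂ ∈ S := by
  obtain ⟨R₁₂, h₁, h₂, e₁⟩ := doubling_partA hS hB hh hρs hρ0 hρd hhi R hRd hRi
  obtain ⟨R₂, h₃, h₄, e₂⟩ := doubling_partB hS hB hh hρs hρ0 hhi R₁₂ h₁ h₂
  refine ⟨R₂, h₃, h₄, ?_⟩
  have : 2 • of R - of R₂ = (2 • of R - of R₁₂) + (of R₁₂ - of R₂) := by abel
  rw [this]
  exact S.add_mem e₁ e₂

end Summit.KontsevichZagierPeriods.K2SymbolChains.JensenIsScissorsProof
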